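import Literature.NumberTheory.Transcendental.ExpDominantSolvability
import Literature.NumberTheory.Transcendental.ZilberField
import HarnessLib

/-!
# Zilber route — definitions: the Exponential-Algebraic Closedness ladder by projection dimension

Typed spine of the EAC case ladder for `ℂ_exp` (cell `pub-schanuel`): Zilber's EC statement
`Literature.NumberTheory.Transcendental.IsExpAlgClosed ℂ` (crux `EacComplex` of the retired route
`Summits/Schanuel/Schanuel/Theses/Zilber.lean`) graded by the Zariski dimension `d` of the additive
projection `π₁(V)`, `EacOfProjDim n d`, with `IsExpAlgClosed ℂ ↔ ∀ n d, EacOfProjDim n d`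
(`isExpAlgClosed_complex_iff_forall_eacOfProjDim`), and the first open rung `EacRung32`
(`n = 3`, `d = 2`).

Status of the rungs in print (see `run/shared/lean/pub/pub-schanuel/FRESHNESS.md`):
* `d = n`: Brownawell–Masser, JLMS 95 (2017) Prop. 2 — PROVED in tree as
  `Literature.NumberTheory.Transcendental.BrownawellMasser2017_dominantProjection_holds` (stated with
  `HasDominantAddProjection`, i.e. "no non-zero polynomial in `x` vanishes on `V`", which is the
  `d = n` case);
* `n = 1`: Marker, J. Symb. Logic 71 (2006) (both `d = 0`, `d = 1`);
* `d = 1`, any `n`, additively free: Mantova–Masser, PLMS 129 (2024) Thm 1.1; all of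
  `ℂ² × (ℂˣ)²`: Thm 1.2 there (also Aslanyan–Gallinaro arXiv:2409.12860 §3.4);
* `V = L × W`, `L` linear: Gallinaro, Selecta Math. 29 (2023) Thm 8.8;
* `n = 3, d = 2`: OPEN — "the simplest case of dimension 2 in `ℂ³ × ℂˣ³`" (Mantova–Masser 2024,
  §1 p. 5); new sub-cases in `ZilberEacComplexPunctureDecoupling.lean`,
  `ZilberEacComplexPunctureBM.lean`, `ZilberEacComplexCornerBM.lean` (this cell).

HONEST FRAMING: rungs of EAC; no rung bears on Schanuel's conjecture (no implication between EC and
SC is known or expected, Aslanyan–Gallinaro 2024 p. 15).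
-/

noncomputable section

open Literature.NumberTheory.Transcendental

set_option linter.dupNamespace false

namespace Summit.Schanuel.Schanuel.Theorems

/-- **EAC rung `(n, d)`**: Zilber's Exponential-Algebraic Closedness for `ℂ_exp`
(`Literature.NumberTheory.Transcendental.IsExpAlgClosed ℂ`, verbatim hypotheses: `W ⊆ ℂ^{n ⊕ n}`
irreducible Zariski closed meeting the torus locus, `V = W ∩ (ℂⁿ × (ℂˣ)ⁿ)` rotund, additively
and multiplicatively free, `dim W = n`) restricted to the varieties whose additive projection
`π₁(V) = projAdd '' V ⊆ ℂⁿ` has Zariski dimension `d` (`d : WithBot ℕ∞`, the value type of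
`zariskiDim`). A route-posited grading of the tree statement `IsExpAlgClosed ℂ` (Zilber 2005 §1
axiom (EC); grading by `dim π(V)` as in Mantova–Masser 2024 §1); a parametrized predicate, not a
named fact. -/
def EacOfProjDim (n : ℕ) (d : WithBot ℕ∞) : Prop :=
  ∀ W : Set (Fin n ⊕ Fin n → ℂ), IsIrreducibleClosed ℂ W → (W ∩ torusLocus ℂ n).Nonempty →
    IsRotund ℂ n (W ∩ torusLocus ℂ n) → IsAddFree ℂ n (W ∩ torusLocus ℂ n) →
    IsMulFree ℂ n (W ∩ torusLocus ℂ n) → zariskiDim ℂ W = n →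
    zariskiDim ℂ (projAdd '' (W ∩ torusLocus ℂ n)) = d → (W ∩ expGraph ℂ n).Nonempty

/-- **The first open rung `EC₃,₂`** (Mantova–Masser 2024 §1 p. 5: "It would also be interesting
to extend the investigations to `π(V)` of other dimensions. The simplest case of dimension 2 in
`ℂ³ × ℂˣ³` …"): free rotund irreducible 3-folds `V ⊆ ℂ³ × (ℂˣ)³` whose additive projection is a
surface meet the graph of `exp` — the case `n = 3`, `d = 2` of `EacOfProjDim` (reference:
Mantova–Masser, PLMS 129 (2024), §1 p. 5). An OPEN STATEMENT posited by this cell as the next rung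
(not a published result, not claimed; deliberately carries no cite tag so that it is not filed as a
Literature fact). -/
def EacRung32 : Prop :=
  EacOfProjDim 3 2

/-- The ladder is exhaustive: `ℂ_exp` is exponentially-algebraically closed iff every rung
`EacOfProjDim n d` holds (the additive projection of any `V` has *some* Zariski dimension).
[cite: Zilber2005PseudoExp, §1 axiom (EC)] -/
theorem isExpAlgClosed_complex_iff_forall_eacOfProjDim :
    IsExpAlgClosed ℂ ↔ ∀ (n : ℕ) (d : WithBot ℕ∞), EacOfProjDim n d := by
  constructor
  · intro h n d W hW hne hrot hadd hmul hdim _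
    exact h n W hW hne hrot hadd hmul hdim
  · intro h n W hW hne hrot hadd hmul hdim
    exact h n _ W hW hne hrot hadd hmul hdim rfl

/-- `EC₃,₂` is an instance of EAC: `IsExpAlgClosed ℂ → EacRung32`. [cite: MantovaMasser2023, §1 p.5] -/
theorem eacRung32_of_isExpAlgClosed (h : IsExpAlgClosed ℂ) : EacRung32 :=
  (isExpAlgClosed_complex_iff_forall_eacOfProjDim.mp h) 3 2

end Summit.Schanuel.Schanuel.Theorems
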